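/-
Copyright (c) 2026 the pub-hodgecm-mathlib formalisation cell (harness21).  Prover seat hodgecm-mathlib-K2E3-p37 (g2), Track B «K2-LIT» ∕ h413 =
`stmt-HodgeConjecture-24833`, line `K2_E3_EllipticInputs`, unit U4 «Keys», PART «U4Keys» socket :182 (U4f-χ₁-ram-one-pos)
`sig_K2E3KeysThmTwoContractingRamifiedCharOnePosDepth` (L4 line-lead K2E3-plan (g5); this base's g0 memo `K2/K2E3-p37/g0/CENSUS-U4f-PosDepth.K2E3-p37-g0.md` §9–§10
left the dyadic places «`|2|_w < 1`» OUTSIDE programme A_pos^{=}): programme A_pos brick (iii)-T «THE DEPTH WITNESSES WITHOUT `|2| = 1`» — the family-X and family-Z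
witnesses of ★ p862033 ∕ ★ p861978 with the letter `h2 : |2| = 1` replaced by a TRACE-ONE INTEGER `t` (`t + σt = 1`, `|t| ≤ 1`), conclusions byte-identical; plus the two
discharges of the trace-one letter (`t = 2⁻¹` when `|2| = 1`; `t = a∕(a − σa)` at every unramified `σ`).  REPORT-FIRST 2026-09-04.
-/
import Summits.HodgeConjecture.HodgeConjecture.Theorems.K2E3LevelNDepthWitnessX   -- ★ p862033 (this base, g0): family X at `|2| = 1`; brings ★ Z p861978 (`le_of_mul_le_mul_v`), ★ p861919 (entries), ★ p861613, ★ p861548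
import HarnessLib

/-!
# K2 ∕ E3 «EllipticInputs», unit U4 «Keys» — (U4f-χ₁-ram-one-pos), programme A_pos brick (iii)-T: THE DEPTH WITNESSES ON THE INTERMEDIATE CELLS WITHOUT `|2| = 1`
# «replace `½` by any integer `t` of trace one: family X with `b = −yσy·t`, family Z with `b = c·z⁻¹ − c·t·(z⁻¹ + (σz)⁻¹)`»   [Roche1998 §4; Casselman1995 §6.3; Rogawski1990 §1.10; Serre1979 III §3, V §1]

Cell hodgecm-mathlib, Track B «K2-LIT», crux item H413 = stmt-HodgeConjecture-24833 (route `HCCMUnconditional`, no route verbs); target BY NAME the OPEN tier-0 leaf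
`…K2E3EllipticInputs.U4Keys.sig_K2E3KeysThmTwoContractingRamifiedCharOnePosDepth` (U4Keys ED. 8 :182), design D-I «vanishing functional» at POSITIVE depth.
Author K2E3-p37 (g2).  `--supports stmt-HodgeConjecture-24833 --as helper`; THEOREMS ONLY; MODEL level (`U(σ, Φ₃)(K)`).  NOT THE PAYER.

THE POINT.  ★ `K2E3LevelNDepthWitnessX.exists_familyX_witness` (p862033) and ★ `K2E3LevelNDepthWitnessZ.exists_familyZ_witness` (p861978) — the depth witnesses that make the
intermediate cells `P·ū(x,z)·J_{m+1}` θ-irrelevant — both carry `h2 : |2| = 1`, used ONLY to halve: `b = −yσy∕2` (X) and `b = c(z⁻¹ − (σz)⁻¹)∕2` (Z).  The leaf :182 has no such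
letter.  Halving is replaced by ANY `t ∈ K` with `t + σt = 1` and `|t| ≤ 1`:
* family X: `b := −(yσy)·t`, so `σb = −(yσy)·σt` and `b + σb + yσy = −yσy(t + σt − 1) = 0` (`u(y, b) ∈ N`), `|b| ≤ |y|²` — and every valuation bound of ★ X survives with
  `|b| = |y|²` weakened to `|b| ≤ |y|²`;
* family Z (`σc = c`): `b := c·z⁻¹ − c·t·(z⁻¹ + (σz)⁻¹)`, so `b + σb = c(z⁻¹ + (σz)⁻¹)(1 − t − σt) = 0` (`u(0, b) ∈ N`), and on `ū(x, z)` (`z + σz = −xσx`):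
  `bz·σz = c·σz + c·t·xσx`, `(bz − c)·σz = c·t·xσx`, whence `|bz| ≤ |c|` and `|bz − c| ≤ |c|·|x|²∕|z| ≤ |ϖ|^{m+1}` exactly as in ★ Z (there with `2σz` for `σz`).
With `t = 2⁻¹` (`|2| = 1`) these ARE the ★ witnesses; so §2 supersedes `h2` at every place holding a trace-one integer: all non-dyadic `w` (§3 `exists_traceOne_of_v_two_eq_one`)
and all UNRAMIFIED `w`, dyadic included (§3 `exists_traceOne_of_v_sub_conj_eq_one`: `t = a∕(a − σa)` for an integral `a` with `|a − σa| = 1`, i.e. `σ̄ ≠ id` on the residue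
field).  Only the wildly ramified dyadic places (`Tr(𝒪_w) ⊆ 𝔭_v`, no trace-one integer) stay outside — the honest residual of programme A_pos^{=}.
* §1 algebra and valuations of the two families (`familyXT_*`, `familyZT_*`).
* §2 **`exists_familyX_witness_of_traceOne`**, **`exists_familyZ_witness_of_traceOne`** (statements = ★ X ∕ ★ Z with `h2 ↦ (ht, hvt)`, conclusions byte-identical).
* §3 the discharges `exists_traceOne_of_v_two_eq_one`, `exists_traceOne_of_v_sub_conj_eq_one`.
HONEST LABEL: HC_CM is proved only modulo the 7 printed citations (2 remaining named inputs: hLiu418 = stmt-HodgeConjecture-24832, h413 = stmt-HodgeConjecture-24833)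
until rung 0 closes; count-neutral — this file does NOT pay the leaf; no printed citation is discharged.

## References
* [Roche1998] A. Roche, *Types and Hecke algebras for principal series representations of split reductive p-adic groups*, Ann. Sci. ÉNS (4) 31 (1998), §4.
* [Casselman1995] W. Casselman, *Introduction to the theory of admissible representations of `p`-adic reductive groups* (1995), §6.3.
* [Rogawski1990] J. D. Rogawski, *Automorphic Representations of Unitary Groups in Three Variables*, Ann. of Math. Stud. 123 (1990), §1.9–§1.10 pp. 8–9.
* [Serre1979] J.-P. Serre, *Local Fields*, GTM 67 (1979), Ch. II §1, Ch. III §3, Ch. V §1.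
-/

set_option autoImplicit false
-- the mandated namespace repeats the single-problem summit's segment (`HodgeConjecture.HodgeConjecture`)
set_option linter.dupNamespace false

noncomputable section

open Matrix Literature.NumberTheory.Automorphic Literature.NumberTheory.Automorphic.UnitaryGroup
open scoped Matrix MatrixGroups WithZero Pointwise

namespace Summit.HodgeConjecture.HodgeConjecture.Cruxes.H413.K2E3LevelNDepthWitnessTraceOne

open Summit.HodgeConjecture.HodgeConjecture.Cruxes.H413
open Summit.HodgeConjecture.HodgeConjecture.Cruxes.H413.K2E3LevelNDepthWitnessZ
open Summit.HodgeConjecture.HodgeConjecture.Cruxes.H413.K2E3LevelNDepthWitnessX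

/-! ## §1 Algebra and valuations of the two trace-one families -/

section Algebra

variable {K : Type*} [Field K] (σ : K →+* K) (hσ : ∀ a, σ (σ a) = a)

include hσ in
/-- **Family X (trace-one form) lies in `N`**: for `t + σt = 1` and `b := −(yσy)·t`, `b + σb + yσy = 0`. [cite: Rogawski1990, §1.10 p. 9] -/
theorem familyXT_rel {y b t : K} (ht : t + σ t = 1) (hb : b = -(y * σ y) * t) : b + σ b + y * σ y = 0 := by
  rw [hb]
  simp only [map_mul, map_neg, hσ]
  linear_combination (-(y * σ y)) * ht

include hσ in
/-- **Family Z (trace-one form) is imaginary**: for `σc = c`, `t + σt = 1` and `b := c·z⁻¹ − c·t·(z⁻¹ + (σz)⁻¹)`, `b + σb = 0` (so `u(0, b) ∈ N`).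
[cite: Rogawski1990, §1.10 p. 9] -/
theorem familyZT_rel {c z b t : K} (hσc : σ c = c) (ht : t + σ t = 1) (hb : b = c * z⁻¹ - c * t * (z⁻¹ + (σ z)⁻¹)) :
    b + σ b + 0 * σ 0 = 0 := by
  rw [hb]
  simp only [map_sub, map_mul, map_add, map_inv₀, hσ, hσc]
  linear_combination (-(c * (z⁻¹ + (σ z)⁻¹))) * ht

/-- **THE KEY IDENTITY `bz·σz = c·σz + c·t·xσx`** for `b = c·z⁻¹ − c·t·(z⁻¹ + (σz)⁻¹)` on `ū(x, z)` (`z + σz + xσx = 0`). [cite: Rogawski1990, §1.10 p. 9] -/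
theorem familyZT_mul_eq {c x z b t : K} (hrel : z + σ z + x * σ x = 0) (hz : z ≠ 0) (hσz : σ z ≠ 0)
    (hb : b = c * z⁻¹ - c * t * (z⁻¹ + (σ z)⁻¹)) :
    b * z * σ z = c * σ z + c * t * (x * σ x) := by
  have e1 : z⁻¹ * z = 1 := inv_mul_cancel₀ hz
  have e2 : (σ z)⁻¹ * σ z = 1 := inv_mul_cancel₀ hσz
  have h1 : b * z * σ z = c * σ z - c * t * (σ z + z) := by
    rw [hb]
    linear_combination (c * σ z - c * t * σ z) * e1 - (c * t * z) * e2
  rw [h1]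
  linear_combination (-(c * t)) * hrel

/-- `(bz − c)·σz = c·t·xσx`. [cite: Rogawski1990, §1.10 p. 9] -/
theorem familyZT_sub_mul_eq {c x z b t : K} (hrel : z + σ z + x * σ x = 0) (hz : z ≠ 0) (hσz : σ z ≠ 0)
    (hb : b = c * z⁻¹ - c * t * (z⁻¹ + (σ z)⁻¹)) :
    (b * z - c) * σ z = c * t * (x * σ x) := by
  linear_combination familyZT_mul_eq σ hrel hz hσz hb

end Algebra

section Valuation

variable {K : Type*} [Field K] [Valued K ℤᵐ⁰] [ValuativeRel K] [(Valued.v : Valuation K ℤᵐ⁰).Compatible]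
  (σ : K →+* K) {ϖ : K} {J : Matrix (Fin 3) (Fin 3) K} (hJ : J = (StdForm.antidiagonal 3).over K)
  (hσ : ∀ a, σ (σ a) = a) (hvσ : ∀ a, Valued.v (σ a) = Valued.v a) (hvϖ : Valued.v ϖ = WithZero.exp (-1 : ℤ))
  {m : ℕ} (gn : GL (Fin 3) K) (hgn : (gn : Matrix (Fin 3) (Fin 3) K) = Matrix.diagonal ![(1 : K), 1, ϖ ^ (m + 1)])

omit [ValuativeRel K] [(Valued.v : Valuation K ℤᵐ⁰).Compatible] in
include hvσ in
/-- **The valuations of `y` and `b` in family X (trace-one form)**: `|y|·|x| = |c|`, `|b| ≤ |y|²` (`|t| ≤ 1`). [cite: Serre1979, Ch. II §1] -/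
theorem familyXT_v_y_mul {c x y b t : K} (hy : y = -c / σ x) (hb : b = -(y * σ y) * t) (hx0 : x ≠ 0) (hvt : Valued.v t ≤ 1) :
    Valued.v y * Valued.v x = Valued.v c ∧ Valued.v b ≤ Valued.v y * Valued.v y := by
  have hσx : σ x ≠ 0 := (map_ne_zero σ).2 hx0
  refine ⟨?_, ?_⟩
  · rw [← hvσ x, ← map_mul, familyX_y_mul σ hy hσx, Valuation.map_neg]
  · rw [hb, map_mul, Valuation.map_neg, map_mul, hvσ]
    exact (mul_le_mul' le_rfl hvt).trans_eq (mul_one _)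

omit [ValuativeRel K] [(Valued.v : Valuation K ℤᵐ⁰).Compatible] in
include hvσ in
/-- **`|bz| ≤ |c| ≤ |ϖ|ᵐ`** in family Z (trace-one form): `|bz|·|σz| = |c·σz + c·t·xσx| ≤ |c|·|z|` (`|x|² ≤ |z||ϖ| ≤ |z|`, `|t| ≤ 1`). [cite: Serre1979, Ch. II §1] -/
theorem familyZT_v_bz_le {c x z b t : K} (hrel : z + σ z + x * σ x = 0) (hc : Valued.v c ≤ Valued.v ϖ ^ m)
    (hxz : Valued.v x * Valued.v x ≤ Valued.v z * Valued.v ϖ) (hvt : Valued.v t ≤ 1) (hz : z ≠ 0) (hvϖ1 : Valued.v ϖ ≤ 1)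
    (hb : b = c * z⁻¹ - c * t * (z⁻¹ + (σ z)⁻¹)) :
    Valued.v (b * z) ≤ Valued.v ϖ ^ m := by
  have hσz : σ z ≠ 0 := (map_ne_zero σ).2 hz
  have hvz0 : Valued.v z ≠ 0 := (Valuation.ne_zero_iff _).2 hz
  have key := congrArg Valued.v (familyZT_mul_eq σ hrel hz hσz hb)
  rw [map_mul Valued.v (b * z) (σ z), hvσ] at key
  -- `|c·σz + c·t·xσx| ≤ |c|·|z|`
  have hR : Valued.v (c * σ z + c * t * (x * σ x)) ≤ Valued.v c * Valued.v z := by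
    refine Valued.v.map_add_le ?_ ?_
    · rw [map_mul, hvσ]
    · rw [map_mul, map_mul, map_mul, hvσ, mul_assoc]
      refine mul_le_mul' le_rfl ?_
      exact (mul_le_mul' hvt (hxz.trans (mul_le_of_le_one_right' hvϖ1))).trans_eq (one_mul _)
  rw [← key] at hR
  exact (le_of_mul_le_mul_v hR hvz0).trans hc

omit [ValuativeRel K] [(Valued.v : Valuation K ℤᵐ⁰).Compatible] in
include hvσ in
/-- **`|bz − c| ≤ |ϖ|^{m+1}`** in family Z (trace-one form): `|bz − c|·|σz| = |c|·|t|·|x|² ≤ |ϖ|ᵐ·|z|·|ϖ|`. [cite: Serre1979, Ch. II §1] -/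
theorem familyZT_v_sub_le {c x z b t : K} (hrel : z + σ z + x * σ x = 0) (hc : Valued.v c ≤ Valued.v ϖ ^ m)
    (hxz : Valued.v x * Valued.v x ≤ Valued.v z * Valued.v ϖ) (hvt : Valued.v t ≤ 1) (hz : z ≠ 0)
    (hb : b = c * z⁻¹ - c * t * (z⁻¹ + (σ z)⁻¹)) :
    Valued.v (b * z - c) ≤ Valued.v ϖ ^ (m + 1) := by
  have hσz : σ z ≠ 0 := (map_ne_zero σ).2 hz
  have hvz0 : Valued.v z ≠ 0 := (Valuation.ne_zero_iff _).2 hz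
  have key := congrArg Valued.v (familyZT_sub_mul_eq σ hrel hz hσz hb)
  rw [map_mul Valued.v (b * z - c) (σ z), hvσ, map_mul Valued.v (c * t) (x * σ x), map_mul Valued.v c t, map_mul Valued.v x (σ x), hvσ] at key
  have h : Valued.v (b * z - c) * Valued.v z ≤ Valued.v ϖ ^ (m + 1) * Valued.v z := by
    rw [key, pow_succ]
    calc Valued.v c * Valued.v t * (Valued.v x * Valued.v x) ≤ Valued.v ϖ ^ m * 1 * (Valued.v z * Valued.v ϖ) :=
          mul_le_mul' (mul_le_mul' hc hvt) hxz
      _ = Valued.v ϖ ^ m * Valued.v ϖ * Valued.v z := by rw [mul_one, mul_comm (Valued.v z) (Valued.v ϖ), ← mul_assoc]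
  exact le_of_mul_le_mul_v h hvz0

/-! ## §2 The witnesses -/

include hJ hσ hvσ hvϖ hgn in
set_option maxHeartbeats 1600000 in
-- one `u ∈ N`, its conjugate's four entries, ten valuation bounds (as ★ X)
/-- **THE DEPTH WITNESS OF FAMILY X, TRACE-ONE FORM** (★ `K2E3LevelNDepthWitnessX.exists_familyX_witness` with `h2 : |2| = 1` replaced by a trace-one integer `t`).
`ū ∈ U(σ, Φ₃)` with matrix `ū(x, z)` (`z + σz + xσx = 0`), `|ϖ|ᵐ ≤ |x| ≤ |ϖ|`, `|z| ≤ |x|·|ϖ|`, `|z|·|ϖ|^{m+1} ≤ (|x|·|ϖ|)²`; ANY `c` with `|c| ≤ |ϖ|ᵐ`; `t + σt = 1`, `|t| ≤ 1`;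
`1 ≤ m`.  Then there is `u ∈ N` (matrix `u(y, b)`, `y = −c∕σx`, `b = −yσy·t`) with `ū⁻¹ u ū ∈ J_{m+1} = K₀ ⊓ gK₀g⁻¹` (`g = diag(1,1,ϖ^{m+1})`) and `(ū⁻¹ u ū)₀₀ = (1 + c)(1 + ε)`,
`|ε| ≤ |ϖ|^{m+1}` — so `θ(ū⁻¹ u ū) = χ₁(1 + c)` for `χ₁` of conductor `≤ m + 1` while `(χδ^{½})(u) = 1`. [cite: Roche1998, §4] [cite: Casselman1995, §6.3] [cite: Rogawski1990, §1.10 p. 9] -/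
theorem exists_familyX_witness_of_traceOne (hm : 1 ≤ m) {nb : ↥(unitaryGroupOfForm σ J)} {x z c t : K}
    (hnb : ((nb : GL (Fin 3) K) : Matrix (Fin 3) (Fin 3) K) = !![1, 0, 0; -σ x, 1, 0; z, x, 1]) (hrel : z + σ z + x * σ x = 0)
    (hx : Valued.v x ≤ Valued.v ϖ) (hxm : Valued.v ϖ ^ m ≤ Valued.v x) (hz : Valued.v z ≤ Valued.v x * Valued.v ϖ)
    (hz2 : Valued.v z * Valued.v ϖ ^ (m + 1) ≤ (Valued.v x * Valued.v ϖ) ^ 2)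
    (hc : Valued.v c ≤ Valued.v ϖ ^ m) (ht : t + σ t = 1) (hvt : Valued.v t ≤ 1) :
    ∃ u : ↥(unitaryGroupOfForm σ J), u ∈ unipotentU σ J ∧
      nb⁻¹ * u * nb ∈ (glInt 3 K).subgroupOf (unitaryGroupOfForm σ J) ⊓ ((glInt 3 K).map (MulAut.conj gn).toMonoidHom).subgroupOf (unitaryGroupOfForm σ J) ∧
      ∃ ε : K, Valued.v ε ≤ Valued.v ϖ ^ (m + 1) ∧
        (((nb⁻¹ * u * nb : ↥(unitaryGroupOfForm σ J)) : GL (Fin 3) K) : Matrix (Fin 3) (Fin 3) K) 0 0 = (1 + c) * (1 + ε) := by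
  have hϖ0 : ϖ ≠ 0 := CartanUnique.uniformizer_ne_zero hvϖ
  have hvϖ0 : Valued.v ϖ ≠ 0 := (Valuation.ne_zero_iff _).2 hϖ0
  have hvϖ1 : Valued.v ϖ ≤ 1 := by rw [hvϖ, ← WithZero.exp_zero, WithZero.exp_le_exp]; norm_num
  have hvϖlt : Valued.v ϖ < 1 := by rw [hvϖ, ← WithZero.exp_zero, WithZero.exp_lt_exp]; norm_num
  have hvϖmlt : Valued.v ϖ ^ m < 1 := pow_lt_one' hvϖlt (Nat.one_le_iff_ne_zero.1 hm)
  have hx0 : x ≠ 0 := fun h => by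
    rw [h, map_zero] at hxm
    exact absurd hxm (not_le.2 (pow_pos (zero_lt_iff.2 hvϖ0) m))
  have hvx0 : Valued.v x ≠ 0 := (Valuation.ne_zero_iff _).2 hx0
  have hσx : σ x ≠ 0 := (map_ne_zero σ).2 hx0
  have hx1 : Valued.v x ≤ 1 := hx.trans hvϖ1
  have hzx : Valued.v z ≤ Valued.v x := hz.trans (mul_le_of_le_one_right' hvϖ1)
  have hz1 : Valued.v z ≤ 1 := hzx.trans hx1
  -- the element `u = u(y, b)`
  obtain ⟨y, hy⟩ : ∃ y : K, y = -c / σ x := ⟨_, rfl⟩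
  obtain ⟨b, hb⟩ : ∃ b : K, b = -(y * σ y) * t := ⟨_, rfl⟩
  obtain ⟨u, huN, hu⟩ := K2E3LowerUnipotentBigCellIntegral.exists_upper_of_rel σ hJ hσ (a := y) (b := b) (familyXT_rel σ hσ ht hb)
  obtain ⟨hyx, hvb⟩ := familyXT_v_y_mul σ hvσ hy hb hx0 hvt
  have hyc : y * σ x = -c := familyX_y_mul σ hy hσx
  -- `|y| ≤ 1`, `|b| ≤ 1`
  have hvy : Valued.v y ≤ 1 := by
    refine le_of_mul_le_mul_v (C := Valued.v x) ?_ hvx0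
    rw [hyx, one_mul]; exact hc.trans hxm
  have hvb1 : Valued.v b ≤ 1 := hvb.trans (mul_le_one' hvy hvy)
  -- the master bound `|c|²|z| ≤ |ϖ|^{m+1}|x|²` and its consequences
  have hM := familyX_master hc hz2 hvϖ0
  -- `|b z| · |x|·|x| ≤ |y|²|x|²|z| = |c|²|z| ≤ |ϖ|^{m+1} · |x|·|x|`
  have hbz : Valued.v (b * z) ≤ Valued.v ϖ ^ (m + 1) := by
    refine le_of_mul_le_mul_v (C := Valued.v x * Valued.v x) ?_ (mul_ne_zero hvx0 hvx0)
    calc Valued.v (b * z) * (Valued.v x * Valued.v x) = Valued.v b * (Valued.v x * Valued.v x) * Valued.v z := by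
          rw [map_mul]; simp only [mul_comm, mul_left_comm]
      _ ≤ Valued.v y * Valued.v y * (Valued.v x * Valued.v x) * Valued.v z :=
          mul_le_mul' (mul_le_mul' hvb le_rfl) le_rfl
      _ = Valued.v y * Valued.v x * (Valued.v y * Valued.v x) * Valued.v z := by simp only [mul_comm, mul_left_comm]
      _ = Valued.v c * Valued.v c * Valued.v z := by rw [hyx]
      _ ≤ Valued.v ϖ ^ (m + 1) * (Valued.v x * Valued.v x) := hM
  -- `|σx · b · z| ≤ |ϖ|^{m+1}` (one spare factor `|x| ≤ 1`)
  have hxbz : Valued.v (σ x * b * z) ≤ Valued.v ϖ ^ (m + 1) := by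
    rw [mul_assoc, map_mul, hvσ]
    exact (mul_le_mul' hx1 hbz).trans_eq (one_mul _)
  -- `|y|·|σx|² = |c|·|x|`
  have hyxx : Valued.v (y * σ x * σ x) ≤ Valued.v ϖ ^ (m + 1) := by
    rw [map_mul, map_mul, hvσ, hyx, pow_succ]
    exact mul_le_mul' hc hx
  -- `|σy · z| ≤ |ϖ|^{m+1}`: `|y||z|·|x| = |c||z| ≤ |c||x||ϖ|`
  have hyz : Valued.v (σ y * z) ≤ Valued.v ϖ ^ (m + 1) := by
    refine le_of_mul_le_mul_v (C := Valued.v x) ?_ hvx0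
    rw [map_mul, hvσ, mul_assoc, mul_comm (Valued.v z), ← mul_assoc, hyx, pow_succ, mul_assoc]
    exact mul_le_mul' hc (by rw [mul_comm]; exact hz)
  have hzy : Valued.v (σ z * y) ≤ Valued.v ϖ ^ (m + 1) := by
    rw [map_mul, hvσ, mul_comm, ← hvσ y, ← map_mul]; exact hyz
  -- `|σz · b · x| = |b z|·|x|`
  have hzbx : Valued.v (σ z * b * x) ≤ Valued.v ϖ ^ (m + 1) := by
    rw [show σ z * b * x = (b * σ z) * x by ring, map_mul, map_mul, hvσ, ← map_mul]
    exact (mul_le_mul' hbz hx1).trans_eq (mul_one _)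
  -- `|x·x·σy| = |x|·|c|`
  have hxxy : Valued.v (x * x * σ y) ≤ Valued.v ϖ ^ (m + 1) := by
    rw [show x * x * σ y = x * (σ y * x) by ring, map_mul, map_mul, hvσ, hyx, pow_succ, mul_comm]
    exact mul_le_mul' hc hx
  -- `|σz · b · z| = |bz|·|z|`
  have hzbz : Valued.v (σ z * b * z) ≤ Valued.v ϖ ^ (m + 1) := by
    rw [show σ z * b * z = (b * z) * σ z by ring, map_mul, hvσ]
    exact (mul_le_mul' hbz hz1).trans_eq (mul_one _)
  -- `|x · σy · z|`, `|σz · y · σx|`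
  have hxyz : Valued.v (x * σ y * z) ≤ Valued.v ϖ ^ (m + 1) := by
    rw [show x * σ y * z = x * (σ y * z) by ring, map_mul]
    exact (mul_le_mul' hx1 hyz).trans_eq (one_mul _)
  have hzyx : Valued.v (σ z * y * σ x) ≤ Valued.v ϖ ^ (m + 1) := by
    rw [show σ z * y * σ x = σ z * (y * σ x) by ring, hyc, map_mul, Valuation.map_neg, hvσ, pow_succ, mul_comm]
    exact mul_le_mul' hc (hzx.trans hx)
  -- `u`, `ū`, hence `j`, integral
  have hvσy : Valued.v (σ y) ≤ 1 := by rw [hvσ]; exact hvy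
  have huK : (u : GL (Fin 3) K) ∈ glInt 3 K := mem_glInt_of_coe_eq σ hJ hvσ hu fun i j => by
    fin_cases i <;> fin_cases j <;> simp [hvb1, hvy, hvσy]
  have hnbK : (nb : GL (Fin 3) K) ∈ glInt 3 K := mem_glInt_of_coe_eq_lower σ hJ hvσ hnb hx1 hz1
  have hjK : nb⁻¹ * u * nb ∈ (glInt 3 K).subgroupOf (unitaryGroupOfForm σ J) :=
    Subgroup.mul_mem _ (Subgroup.mul_mem _ (Subgroup.inv_mem _ (Subgroup.mem_subgroupOf.2 hnbK)) (Subgroup.mem_subgroupOf.2 huK))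
      (Subgroup.mem_subgroupOf.2 hnbK)
  -- the entries
  have e00 := K2E3LowerUnipotentConjUpperEntries.conj_upper_apply_zero_zero_of_familyX σ hJ hσ hnb hu hyc
  have e10 := K2E3LowerUnipotentConjUpperEntries.conj_upper_apply_one_zero σ hJ hσ hnb hu
  have e20 := K2E3LowerUnipotentConjUpperEntries.conj_upper_apply_two_zero σ hJ hσ hnb hu hrel
  have e21 := K2E3LowerUnipotentConjUpperEntries.conj_upper_apply_two_one σ hJ hσ hnb hu
  refine ⟨u, huN, ?_, ?_⟩
  · rw [K2E3IwahoriLevelNFactorisation.mem_glInt_inf_conj_glInt_pow_iff σ hJ hvσ hvϖ gn hgn]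
    refine ⟨(mem_glInt_subgroupOf_iff σ hJ hvσ _).1 hjK, ?_, ?_, ?_⟩
    · rw [e20]
      refine Valued.v.map_sub_le (Valued.v.map_add_le hzbz hxyz) hzyx
    · rw [e21]
      exact Valued.v.map_add_le (Valued.v.map_add_le hzy hzbx) hxxy
    · rw [e10]
      refine Valued.v.map_sub_le (Valued.v.map_add_le ?_ hxbz) hyz
      rw [Valuation.map_neg]; exact hyxx
  · have hclt : Valued.v c < Valued.v (1 : K) := by rw [Valuation.map_one]; exact lt_of_le_of_lt hc hvϖmlt
    have h1c : Valued.v (1 + c) = 1 := by rw [Valuation.map_add_eq_of_lt_left _ hclt, Valuation.map_one]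
    have h1c0 : (1 + c : K) ≠ 0 := fun h => by rw [h, map_zero] at h1c; exact zero_ne_one h1c
    refine ⟨b * z / (1 + c), ?_, ?_⟩
    · rw [map_div₀, h1c, div_one]; exact hbz
    · rw [e00]
      field_simp

include hJ hσ hvσ hvϖ hgn in
set_option maxHeartbeats 800000 in
-- one `u ∈ N`, its conjugate's four entries, six valuation bounds (as ★ Z)
/-- **THE DEPTH WITNESS OF FAMILY Z, TRACE-ONE FORM** (★ `K2E3LevelNDepthWitnessZ.exists_familyZ_witness` with `h2 : |2| = 1` replaced by a trace-one integer `t`).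
`ū ∈ U(σ, Φ₃)` with matrix `ū(x, z)` (`z + σz + xσx = 0`), `|x| ≤ |ϖ|`, `|ϖ|ᵐ ≤ |z| ≤ |ϖ|`, `|x|² ≤ |z||ϖ|`; `c` with `σc = c`, `|c| ≤ |ϖ|ᵐ`; `t + σt = 1`, `|t| ≤ 1`; `1 ≤ m`.
Then there is `u ∈ N` (matrix `u(0, b)`, `b = c·z⁻¹ − c·t·(z⁻¹ + (σz)⁻¹)`) with `ū⁻¹ u ū ∈ J_{m+1} = K₀ ⊓ g K₀ g⁻¹` (`g = diag(1,1,ϖ^{m+1})`) and `(ū⁻¹ u ū)₀₀ = (1 + c)(1 + ε)`,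
`|ε| ≤ |ϖ|^{m+1}` — so `θ(ū⁻¹ u ū) = χ₁(1 + c)` for `χ₁` of conductor `≤ m + 1`, while `(χδ^{½})(u) = 1`. [cite: Roche1998, §4] [cite: Casselman1995, §6.3] [cite: Rogawski1990, §1.10 p. 9] -/
theorem exists_familyZ_witness_of_traceOne (hm : 1 ≤ m) {nb : ↥(unitaryGroupOfForm σ J)} {x z c t : K}
    (hnb : ((nb : GL (Fin 3) K) : Matrix (Fin 3) (Fin 3) K) = !![1, 0, 0; -σ x, 1, 0; z, x, 1]) (hrel : z + σ z + x * σ x = 0)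
    (hx : Valued.v x ≤ Valued.v ϖ) (hz1 : Valued.v z ≤ Valued.v ϖ) (hzm : Valued.v ϖ ^ m ≤ Valued.v z)
    (hxz : Valued.v x * Valued.v x ≤ Valued.v z * Valued.v ϖ)
    (hσc : σ c = c) (hc : Valued.v c ≤ Valued.v ϖ ^ m) (ht : t + σ t = 1) (hvt : Valued.v t ≤ 1) :
    ∃ u : ↥(unitaryGroupOfForm σ J), u ∈ unipotentU σ J ∧
      nb⁻¹ * u * nb ∈ (glInt 3 K).subgroupOf (unitaryGroupOfForm σ J) ⊓ ((glInt 3 K).map (MulAut.conj gn).toMonoidHom).subgroupOf (unitaryGroupOfForm σ J) ∧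
      ∃ ε : K, Valued.v ε ≤ Valued.v ϖ ^ (m + 1) ∧
        (((nb⁻¹ * u * nb : ↥(unitaryGroupOfForm σ J)) : GL (Fin 3) K) : Matrix (Fin 3) (Fin 3) K) 0 0 = (1 + c) * (1 + ε) := by
  have hϖ0 : ϖ ≠ 0 := CartanUnique.uniformizer_ne_zero hvϖ
  have hvϖ0 : Valued.v ϖ ≠ 0 := (Valuation.ne_zero_iff _).2 hϖ0
  have hvϖ1 : Valued.v ϖ ≤ 1 := by rw [hvϖ, ← WithZero.exp_zero, WithZero.exp_le_exp]; norm_num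
  have hvϖlt : Valued.v ϖ < 1 := by rw [hvϖ, ← WithZero.exp_zero, WithZero.exp_lt_exp]; norm_num
  have hz : z ≠ 0 := fun h => by
    rw [h, map_zero] at hzm
    exact absurd hzm (not_le.2 (pow_pos (zero_lt_iff.2 hvϖ0) m))
  have hvz0 : Valued.v z ≠ 0 := (Valuation.ne_zero_iff _).2 hz
  -- the element `u = u(0, b)`
  obtain ⟨b, hb⟩ : ∃ b : K, b = c * z⁻¹ - c * t * (z⁻¹ + (σ z)⁻¹) := ⟨_, rfl⟩
  obtain ⟨u, huN, hu⟩ := K2E3LowerUnipotentBigCellIntegral.exists_upper_of_rel σ hJ hσ (a := 0) (b := b) (familyZT_rel σ hσ hσc ht hb)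
  -- valuations of `bz`, `b`
  have hvbz : Valued.v (b * z) ≤ Valued.v ϖ ^ m := familyZT_v_bz_le σ hvσ hrel hc hxz hvt hz hvϖ1 hb
  have hvb : Valued.v b ≤ 1 := by
    rw [show b = b * z * z⁻¹ by rw [mul_inv_cancel_right₀ hz], map_mul, map_inv₀]
    calc Valued.v (b * z) * (Valued.v z)⁻¹ ≤ Valued.v z * (Valued.v z)⁻¹ := mul_le_mul' (hvbz.trans hzm) le_rfl
      _ = 1 := mul_inv_cancel₀ hvz0
  -- `u`, `ū`, hence `j = ū⁻¹ u ū`, are integral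
  have huK : (u : GL (Fin 3) K) ∈ glInt 3 K := mem_glInt_of_coe_eq σ hJ hvσ hu fun i j => by
    fin_cases i <;> fin_cases j <;> simp [hvb]
  have hnbK : (nb : GL (Fin 3) K) ∈ glInt 3 K :=
    mem_glInt_of_coe_eq_lower σ hJ hvσ hnb (hx.trans hvϖ1) (hz1.trans hvϖ1)
  have hjK : nb⁻¹ * u * nb ∈ (glInt 3 K).subgroupOf (unitaryGroupOfForm σ J) :=
    Subgroup.mul_mem _ (Subgroup.mul_mem _ (Subgroup.inv_mem _ (Subgroup.mem_subgroupOf.2 hnbK)) (Subgroup.mem_subgroupOf.2 huK))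
      (Subgroup.mem_subgroupOf.2 hnbK)
  -- the four entries (family Z, `y = 0`)
  obtain ⟨e00, e10, e20, e21⟩ := K2E3LowerUnipotentConjUpperEntries.conj_upper_entries_of_y_eq_zero σ hJ hσ hnb hu hrel rfl
  refine ⟨u, huN, ?_, ?_⟩
  · -- `j ∈ J_{m+1}` by the level test
    rw [K2E3IwahoriLevelNFactorisation.mem_glInt_inf_conj_glInt_pow_iff σ hJ hvσ hvϖ gn hgn]
    refine ⟨(mem_glInt_subgroupOf_iff σ hJ hvσ _).1 hjK, ?_, ?_, ?_⟩
    · -- `(2,0) = σz · bz`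
      rw [e20, mul_assoc, map_mul, hvσ, pow_succ, mul_comm (Valued.v ϖ ^ m)]
      exact mul_le_mul' hz1 hvbz
    · -- `(2,1) = σz · b · x = (bz) · x · (σz ∕ z)`: valuation `|bz|·|x|`
      rw [e21, show σ z * b * x = (b * z) * x * (σ z / z) by field_simp, map_mul, map_mul, map_div₀, hvσ, div_self hvz0, mul_one,
        pow_succ]
      exact mul_le_mul' hvbz hx
    · -- `(1,0) = σx · bz`
      rw [e10, mul_assoc, map_mul, hvσ, pow_succ, mul_comm (Valued.v ϖ ^ m)]
      exact mul_le_mul' hx hvbz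
  · -- `j₀₀ = 1 + bz = (1 + c)(1 + ε)`, `ε = (bz − c)∕(1 + c)`
    have hvϖmlt : Valued.v ϖ ^ m < 1 := pow_lt_one' hvϖlt (Nat.one_le_iff_ne_zero.1 hm)
    have hclt : Valued.v c < Valued.v (1 : K) := by rw [Valuation.map_one]; exact lt_of_le_of_lt hc hvϖmlt
    have h1c : Valued.v (1 + c) = 1 := by rw [Valuation.map_add_eq_of_lt_left _ hclt, Valuation.map_one]
    have h1c0 : (1 + c : K) ≠ 0 := fun h => by rw [h, map_zero] at h1c; exact zero_ne_one h1c
    refine ⟨(b * z - c) / (1 + c), ?_, ?_⟩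
    · rw [map_div₀, h1c, div_one]
      exact familyZT_v_sub_le σ hvσ hrel hc hxz hvt hz hb
    · rw [e00]
      field_simp
      ring

/-! ## §3 Discharging the trace-one letter -/

omit [ValuativeRel K] [(Valued.v : Valuation K ℤᵐ⁰).Compatible] in
/-- **Non-dyadic places**: if `|2| = 1` then `t := 2⁻¹` is a trace-one integer (`σ 2⁻¹ = 2⁻¹`). [cite: Serre1979, Ch. II §1] -/
theorem exists_traceOne_of_v_two_eq_one (h2 : Valued.v (2 : K) = 1) : ∃ t : K, t + σ t = 1 ∧ Valued.v t ≤ 1 := by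
  have h20 : (2 : K) ≠ 0 := fun h => by rw [h, map_zero] at h2; exact zero_ne_one h2
  refine ⟨2⁻¹, ?_, ?_⟩
  · rw [map_inv₀, map_ofNat, ← two_mul, mul_inv_cancel₀ h20]
  · rw [map_inv₀, h2, inv_one]

omit [ValuativeRel K] [(Valued.v : Valuation K ℤᵐ⁰).Compatible] in
include hσ in
/-- **Unramified places (dyadic included)**: if some integral `a` has `|a − σa| = 1` (the involution is non-trivial on the residue field), then `t := a∕(a − σa)` is a trace-one
integer: `σt = σa∕(σa − a) = −σa∕(a − σa)`, `t + σt = 1`, `|t| = |a| ≤ 1`. [cite: Serre1979, Ch. III §3, Ch. V §1] -/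
theorem exists_traceOne_of_v_sub_conj_eq_one {a : K} (ha : Valued.v a ≤ 1) (hσa : Valued.v (a - σ a) = 1) :
    ∃ t : K, t + σ t = 1 ∧ Valued.v t ≤ 1 := by
  have hd : a - σ a ≠ 0 := fun h => by rw [h, map_zero] at hσa; exact zero_ne_one hσa
  refine ⟨a / (a - σ a), ?_, ?_⟩
  · rw [map_div₀, map_sub, hσ, show σ a - a = -(a - σ a) by ring, div_neg, ← sub_eq_add_neg, ← sub_div, div_self hd]
  · rw [map_div₀, hσa, div_one]; exact ha

end Valuation

end Summit.HodgeConjecture.HodgeConjecture.Cruxes.H413.K2E3LevelNDepthWitnessTraceOne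

end
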